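import Literature.NumberTheory.Weil1964.AdelicMetaplecticFinRep
import Literature.NumberTheory.Weil1964.AdelicMetaplecticSeesawCharacter
import Literature.NumberTheory.Weil1964.AdelicMetaplecticDirectSum
import Literature.NumberTheory.Automorphic.AdelicSchwartzBruhatDirectSumPure
import HarnessLib

/-!
# The finite factor `ω_f` over a see-saw sum is the tensor of the members' finite factors, up to the see-saw character

Topic `NumberTheory/Weil1964`; namespace `Literature.NumberTheory.Weil1964`.  THEOREMS ONLY (no definition, no named fact, no
instance, no `sorry`).  Cell `hodgecm-mathlib`, (β)-glue node G1 of `A-plan/GS6-HOIST-SPEC.md` (director s114 (1)); statement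
spec = probe P2 `GS6-hoist-P2-finPairRepBlockDiag` (B-p21 g12).  Books 0: nothing here is a named fact or moves a binder of HC_CM.

SETTING ([Weil1964] Chap. III n° 37–38; [Kudla1984] §1).  A number field `F`, invertible adelic Gram matrices `T₁ ∈ M_{ι₁}(𝔸_F)`,
`T₂ ∈ M_{ι₂}(𝔸_F)`, their orthogonal sum `T = fromBlocks T₁ 0 0 T₂` on `ι₁ ⊕ ι₂`, a group `P` and three homomorphisms
`s : P →* Mp_ψ(W₁ ⊕ W₂)ᶜᵒⁿᵗ`, `s_j : P →* Mp_ψ(W_j)ᶜᵒⁿᵗ` LYING OVER THE SEE-SAW EMBEDDING (`hs : π(s p) = π(s₁ p) ⊕ π(s₂ p)`,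
★ `UnitaryGroup.spSum`) whose symplectic components fix the archimedean vectors (`harch`, `harch₁`, `harch₂` — the hypothesis under
which the FINITE FACTORS `finRepMp` of ★ `AdelicMetaplecticFinRep` are defined: `ω(s p) = 1 ⊗ finRepMp s p` on
`𝒮(𝔸_F^ι) = 𝓢((F ⊗ ℝ)^ι) ⊗ 𝒮((𝔸_F^∞)^ι)`).

RESULTS.
* `finRepMp_finSumEquiv_tmul` — **on products of finite test functions**:
  `finRepMp s p (f₁ ⊠ f₂) = χ(p) • (finRepMp s₁ p f₁ ⊠ finRepMp s₂ p f₂)`, `χ = mpSeesawChar s s₁ s₂` the ★ see-saw character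
  (★ `AdelicMetaplecticSeesawCharacter`), `f₁ ⊠ f₂ = finSumEquiv (f₁ ⊗ f₂)` (★ `FiniteAdeleSchwartzBruhatDirectSum`).  PROOF (pure-tensor
  descent): evaluate the FULL adelic see-saw identity ★ `mpSeesawChar_spec` `ω(s p)(Φ₁ ⊠ Φ₂) = χ(p) • (ω(s₁ p)Φ₁ ⊠ ω(s₂ p)Φ₂)` at the
  pure tensors `Φ_j = φ_j ⊗ f_j` with archimedean test functions `φ_j(0) = 1` (★ `exists_schwartzMap_apply_zero_eq_one`); by ★
  `tensorToSum_tmul` and ★ `omega_map_tmul_finRepMp` (×3) both sides are `(φ₁ ⊠_∞ φ₂) ⊗ (finite part)`, and the finite slice at the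
  archimedean origin (★ `finSliceLM_tmul`, `(φ₁ ⊠_∞ φ₂)(0) = 1`) strips the common archimedean factor.
* `finRepMp_comp_finSumEquiv` (L1) — the same as an identity of linear maps out of `𝒮((𝔸_F^∞)^{ι₁}) ⊗ 𝒮((𝔸_F^∞)^{ι₂})`:
  `finRepMp s p ∘ finSumEquiv = χ(p) • (finSumEquiv ∘ (finRepMp s₁ p ⊗ finRepMp s₂ p))` (`TensorProduct.ext'`);
  `finRepMp_eq_smul_finSumEnd` — `finRepMp s p = χ(p) • (finRepMp s₁ p ⊠ finRepMp s₂ p)` as endomorphisms of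
  `𝒮((𝔸_F^∞)^{ι₁ ⊕ ι₂})` (★ `finSumEnd`, ★ `linearMap_ext_box`).
* `finRepMp_eq_finSumEnd_of_mem_adelicMpTheta` (L1′) — ON THE NOSE at every `p` whose three images are `Θ`-fixing pairs (★
  `mpSeesawChar_eq_one_of_mem_adelicMpTheta`; [Weil1964] n° 41 Thm. 6: rational points); `finRepMp_eq_finSumEnd_of_mpSeesawChar_eq_one`,
  `finSumEquiv_intertwines` (L3) — when the see-saw character is trivial, `finSumEquiv` INTERTWINES the tensor representation
  `finRepMp s₁ ⊗ finRepMp s₂` with `finRepMp s` ([MoeglinVignerasWaldspurger1987] Chap. 2 II.1; the representation-level tensor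
  decomposition of the finite Weil representation of an orthogonal direct sum along the block-diagonal subgroup).

These are the finite-adelic content of `𝐫_𝐀(s₁ ⊕ s₂) = 𝐫_𝐀(s₁) ⊗ 𝐫_𝐀(s₂)`; the consumer (G2–G4 of the SPEC) instantiates `P` with the
finite-adelic see-saw pair `U(V⋆) × U(V⋆^⊥) × U(W)` inside `U(V) × U(W)` and `s, s₁, s₂` with the χ-splittings (`hs` = ★
`UnitaryGroupSeesawBlockDiag`).

## References
* [Weil1964] A. Weil, *Sur certains groupes d'opérateurs unitaires*, Acta Math. 111 (1964), Chap. III n° 37–38 pp. 188–190 (metaplectic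
  representation of an orthogonal direct sum), n° 41 Thm. 6 p. 193.
* [Kudla1984] S. Kudla, *Seesaw dual reductive pairs*, Progr. Math. 46 (1984), §1.
* [MoeglinVignerasWaldspurger1987] C. Mœglin, M.-F. Vignéras, J.-L. Waldspurger, *Correspondances de Howe sur un corps p-adique*, LNM 1291
  (1987), Chap. 2 II.1.
* [GelbartRogawski1991] S. Gelbart, J. Rogawski, Invent. Math. 105 (1991), §3.1 Remark p. 457.
-/

set_option autoImplicit false

noncomputable section

open scoped Matrix TensorProduct
open NumberField NumberField.mixedEmbedding IsDedekindDomain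
open Literature.NumberTheory.Automorphic Literature.RepresentationTheory.HeisenbergGroup

namespace Literature.NumberTheory.Weil1964

variable {F : Type} [Field F] [NumberField F]
variable {ι₁ ι₂ : Type} [Fintype ι₁] [DecidableEq ι₁] [Fintype ι₂] [DecidableEq ι₂]
variable {T₁ : Matrix ι₁ ι₁ (AdeleRing (𝓞 F) F)} {T₂ : Matrix ι₂ ι₂ (AdeleRing (𝓞 F) F)}
variable {P : Type*} [Group P]
  (s : P →* adelicMpCont F (ι₁ ⊕ ι₂) (Matrix.fromBlocks T₁ 0 0 T₂))
  (s₁ : P →* adelicMpCont F ι₁ T₁) (s₂ : P →* adelicMpCont F ι₂ T₂)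
  (hs : ∀ p : P, adelicMpCont.proj F (ι₁ ⊕ ι₂) (Matrix.fromBlocks T₁ 0 0 T₂) (s p) =
    UnitaryGroup.spSum T₁ T₂ (adelicMpCont.proj F ι₁ T₁ (s₁ p), adelicMpCont.proj F ι₂ T₂ (s₂ p)))
  (hT₁ : IsUnit T₁) (hT₂ : IsUnit T₂) (hT : IsUnit (Matrix.fromBlocks T₁ 0 0 T₂))
  (harch : ∀ (p : P) (a w : ι₁ ⊕ ι₂ → mixedSpace F),
    (adelicMpCont.proj F (ι₁ ⊕ ι₂) (Matrix.fromBlocks T₁ 0 0 T₂) (s p)).1 (archVec F (ι₁ ⊕ ι₂) a, archVec F (ι₁ ⊕ ι₂) w) =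
      (archVec F (ι₁ ⊕ ι₂) a, archVec F (ι₁ ⊕ ι₂) w))
  (harch₁ : ∀ (p : P) (a w : ι₁ → mixedSpace F),
    (adelicMpCont.proj F ι₁ T₁ (s₁ p)).1 (archVec F ι₁ a, archVec F ι₁ w) = (archVec F ι₁ a, archVec F ι₁ w))
  (harch₂ : ∀ (p : P) (a w : ι₂ → mixedSpace F),
    (adelicMpCont.proj F ι₂ T₂ (s₂ p)).1 (archVec F ι₂ a, archVec F ι₂ w) = (archVec F ι₂ a, archVec F ι₂ w))

/-! ### §1 The identity on products of finite test functions (pure-tensor descent) -/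

/-- **`finRepMp s p (f₁ ⊠ f₂) = χ(p) • (finRepMp s₁ p f₁ ⊠ finRepMp s₂ p f₂)`** — the finite factor over the see-saw sum on products,
up to the see-saw character `χ = mpSeesawChar s s₁ s₂`: ★ `mpSeesawChar_spec` at the pure tensors `φ_j ⊗ f_j` with `φ_j(0) = 1`, read
through ★ `tensorToSum_tmul` / ★ `omega_map_tmul_finRepMp` and stripped of the common archimedean factor by the finite slice at `0`.
[cite: Weil1964, Chap. III n° 37–38 pp. 188–190] [cite: Kudla1984, §1] -/
theorem finRepMp_finSumEquiv_tmul (p : P) (f₁ : FinSB F ι₁) (f₂ : FinSB F ι₂) :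
    finRepMp hT s harch p (finSumEquiv F ι₁ ι₂ (f₁ ⊗ₜ f₂)) =
      (mpSeesawChar s s₁ s₂ hs hT₁ hT₂ p : ℂ) •
        finSumEquiv F ι₁ ι₂ (finRepMp hT₁ s₁ harch₁ p f₁ ⊗ₜ finRepMp hT₂ s₂ harch₂ p f₂) := by
  -- archimedean test functions with `φ_j(0) = 1`, so that `(φ₁ ⊠_∞ φ₂)(0) = 1`
  obtain ⟨φ₁, hφ₁⟩ := exists_schwartzMap_apply_zero_eq_one (F := F) ι₁
  obtain ⟨φ₂, hφ₂⟩ := exists_schwartzMap_apply_zero_eq_one (F := F) ι₂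
  have hA : archBoxTensor φ₁ φ₂ (0 : ι₁ ⊕ ι₂ → mixedSpace F) = 1 := by
    rw [archBoxTensor_apply]
    change φ₁ 0 * φ₂ 0 = 1
    rw [hφ₁, hφ₂, one_mul]
  -- the see-saw identity at the pure tensors `φ_j ⊗ f_j` (★ `mpSeesawChar_spec`)
  have key := mpSeesawChar_spec s s₁ s₂ hs hT₁ hT₂ p (piSchwartzBruhatEquiv F ι₁ (φ₁ ⊗ₜ f₁))
    (piSchwartzBruhatEquiv F ι₂ (φ₂ ⊗ₜ f₂))
  -- both sides are `(φ₁ ⊠_∞ φ₂) ⊗ (finite part)` (no `rw` on the adelic operator terms: `congrArg` chains only)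
  have e1 := tensorToSum_tmul φ₁ f₁ φ₂ f₂
  have e2 := omega_map_tmul_finRepMp hT₁ s₁ harch₁ p φ₁ f₁
  have e3 := omega_map_tmul_finRepMp hT₂ s₂ harch₂ p φ₂ f₂
  have e4 := tensorToSum_tmul φ₁ (finRepMp hT₁ s₁ harch₁ p f₁) φ₂ (finRepMp hT₂ s₂ harch₂ p f₂)
  have e5 := omega_map_tmul_finRepMp hT s harch p (archBoxTensor φ₁ φ₂) (finSumEquiv F ι₁ ι₂ (f₁ ⊗ₜ f₂))
  have c : piSchwartzBruhatEquiv F (ι₁ ⊕ ι₂)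
        (archBoxTensor φ₁ φ₂ ⊗ₜ finRepMp hT s harch p (finSumEquiv F ι₁ ι₂ (f₁ ⊗ₜ f₂))) =
      (mpSeesawChar s s₁ s₂ hs hT₁ hT₂ p : ℂ) •
        piSchwartzBruhatEquiv F (ι₁ ⊕ ι₂)
          (archBoxTensor φ₁ φ₂ ⊗ₜ finSumEquiv F ι₁ ι₂ (finRepMp hT₁ s₁ harch₁ p f₁ ⊗ₜ finRepMp hT₂ s₂ harch₂ p f₂)) :=
    calc piSchwartzBruhatEquiv F (ι₁ ⊕ ι₂)
          (archBoxTensor φ₁ φ₂ ⊗ₜ finRepMp hT s harch p (finSumEquiv F ι₁ ι₂ (f₁ ⊗ₜ f₂)))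
        = adelicMpCont.omega F (ι₁ ⊕ ι₂) (Matrix.fromBlocks T₁ 0 0 T₂) (s p)
            (piSchwartzBruhatEquiv F (ι₁ ⊕ ι₂) (archBoxTensor φ₁ φ₂ ⊗ₜ finSumEquiv F ι₁ ι₂ (f₁ ⊗ₜ f₂))) := e5.symm
      _ = adelicMpCont.omega F (ι₁ ⊕ ι₂) (Matrix.fromBlocks T₁ 0 0 T₂) (s p)
            (tensorToSum F ι₁ ι₂ (piSchwartzBruhatEquiv F ι₁ (φ₁ ⊗ₜ f₁)) (piSchwartzBruhatEquiv F ι₂ (φ₂ ⊗ₜ f₂))) :=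
          congrArg _ e1.symm
      _ = (mpSeesawChar s s₁ s₂ hs hT₁ hT₂ p : ℂ) •
            tensorToSum F ι₁ ι₂ (adelicMpCont.omega F ι₁ T₁ (s₁ p) (piSchwartzBruhatEquiv F ι₁ (φ₁ ⊗ₜ f₁)))
              (adelicMpCont.omega F ι₂ T₂ (s₂ p) (piSchwartzBruhatEquiv F ι₂ (φ₂ ⊗ₜ f₂))) := key
      _ = (mpSeesawChar s s₁ s₂ hs hT₁ hT₂ p : ℂ) •
            tensorToSum F ι₁ ι₂ (piSchwartzBruhatEquiv F ι₁ (φ₁ ⊗ₜ finRepMp hT₁ s₁ harch₁ p f₁))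
              (piSchwartzBruhatEquiv F ι₂ (φ₂ ⊗ₜ finRepMp hT₂ s₂ harch₂ p f₂)) :=
          congrArg _ (congrArg₂ (fun x y => tensorToSum F ι₁ ι₂ x y) e2 e3)
      _ = (mpSeesawChar s s₁ s₂ hs hT₁ hT₂ p : ℂ) •
            piSchwartzBruhatEquiv F (ι₁ ⊕ ι₂)
              (archBoxTensor φ₁ φ₂ ⊗ₜ finSumEquiv F ι₁ ι₂ (finRepMp hT₁ s₁ harch₁ p f₁ ⊗ₜ finRepMp hT₂ s₂ harch₂ p f₂)) :=
          congrArg _ e4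
  -- strip the archimedean factor with the finite slice at the origin (★ `finSliceLM_tmul`, `(φ₁ ⊠_∞ φ₂)(0) = 1`)
  have s1 := finSliceLM_tmul (0 : ι₁ ⊕ ι₂ → mixedSpace F) (archBoxTensor φ₁ φ₂)
    (finRepMp hT s harch p (finSumEquiv F ι₁ ι₂ (f₁ ⊗ₜ f₂)))
  have s2 := finSliceLM_tmul (0 : ι₁ ⊕ ι₂ → mixedSpace F) (archBoxTensor φ₁ φ₂)
    (finSumEquiv F ι₁ ι₂ (finRepMp hT₁ s₁ harch₁ p f₁ ⊗ₜ finRepMp hT₂ s₂ harch₂ p f₂))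
  rw [hA, one_smul] at s1 s2
  calc finRepMp hT s harch p (finSumEquiv F ι₁ ι₂ (f₁ ⊗ₜ f₂))
      = finSliceLM F (ι₁ ⊕ ι₂) 0 (piSchwartzBruhatEquiv F (ι₁ ⊕ ι₂)
          (archBoxTensor φ₁ φ₂ ⊗ₜ finRepMp hT s harch p (finSumEquiv F ι₁ ι₂ (f₁ ⊗ₜ f₂)))) := s1.symm
    _ = finSliceLM F (ι₁ ⊕ ι₂) 0 ((mpSeesawChar s s₁ s₂ hs hT₁ hT₂ p : ℂ) •
          piSchwartzBruhatEquiv F (ι₁ ⊕ ι₂)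
            (archBoxTensor φ₁ φ₂ ⊗ₜ finSumEquiv F ι₁ ι₂ (finRepMp hT₁ s₁ harch₁ p f₁ ⊗ₜ finRepMp hT₂ s₂ harch₂ p f₂))) :=
        congrArg _ c
    _ = (mpSeesawChar s s₁ s₂ hs hT₁ hT₂ p : ℂ) • finSliceLM F (ι₁ ⊕ ι₂) 0 (piSchwartzBruhatEquiv F (ι₁ ⊕ ι₂)
          (archBoxTensor φ₁ φ₂ ⊗ₜ finSumEquiv F ι₁ ι₂ (finRepMp hT₁ s₁ harch₁ p f₁ ⊗ₜ finRepMp hT₂ s₂ harch₂ p f₂))) :=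
        map_smul _ _ _
    _ = (mpSeesawChar s s₁ s₂ hs hT₁ hT₂ p : ℂ) •
          finSumEquiv F ι₁ ι₂ (finRepMp hT₁ s₁ harch₁ p f₁ ⊗ₜ finRepMp hT₂ s₂ harch₂ p f₂) := congrArg _ s2

/-! ### §2 (L1) as identities of linear maps -/

/-- **(L1)** `finRepMp s p ∘ finSumEquiv = χ(p) • (finSumEquiv ∘ (finRepMp s₁ p ⊗ finRepMp s₂ p))` on
`𝒮((𝔸_F^∞)^{ι₁}) ⊗ 𝒮((𝔸_F^∞)^{ι₂})` (`TensorProduct.ext'` over §1). [cite: Weil1964, Chap. III n° 37–38 pp. 188–190]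
[cite: MoeglinVignerasWaldspurger1987, Chap. 2 II.1] -/
theorem finRepMp_comp_finSumEquiv (p : P) :
    (finRepMp hT s harch p) ∘ₗ (finSumEquiv F ι₁ ι₂).toLinearMap =
      (mpSeesawChar s s₁ s₂ hs hT₁ hT₂ p : ℂ) •
        ((finSumEquiv F ι₁ ι₂).toLinearMap ∘ₗ
          TensorProduct.map (finRepMp hT₁ s₁ harch₁ p) (finRepMp hT₂ s₂ harch₂ p)) :=
  TensorProduct.ext' fun f₁ f₂ => by
    rw [LinearMap.comp_apply, LinearMap.smul_apply, LinearMap.comp_apply, TensorProduct.map_tmul]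
    exact finRepMp_finSumEquiv_tmul s s₁ s₂ hs hT₁ hT₂ hT harch harch₁ harch₂ p f₁ f₂

/-- **(L1), endomorphism form**: `finRepMp s p = χ(p) • (finRepMp s₁ p ⊠ finRepMp s₂ p)` on `𝒮((𝔸_F^∞)^{ι₁ ⊕ ι₂})`
(★ `finSumEnd`, extensionality on products ★ `linearMap_ext_box`). [cite: Weil1964, Chap. III n° 37–38 pp. 188–190] [cite: Kudla1984, §1] -/
theorem finRepMp_eq_smul_finSumEnd (p : P) :
    (finRepMp hT s harch p) =
      (mpSeesawChar s s₁ s₂ hs hT₁ hT₂ p : ℂ) •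
        finSumEnd (finRepMp hT₁ s₁ harch₁ p) (finRepMp hT₂ s₂ harch₂ p) :=
  linearMap_ext_box fun f₁ f₂ => by
    rw [LinearMap.smul_apply, finSumEnd_apply_tmul]
    exact finRepMp_finSumEquiv_tmul s s₁ s₂ hs hT₁ hT₂ hT harch harch₁ harch₂ p f₁ f₂

/-! ### §3 On the nose: `Θ`-fixing points, trivial see-saw character, the intertwiner -/

include hs in
/-- **(L1′) ON THE NOSE at `Θ`-fixing points**: if `s p`, `s₁ p`, `s₂ p` are `Θ`-fixing pairs (★ `adelicMpTheta`; e.g. rational points under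
[GelbartRogawski1991, Prop. 3.1.1]-compatible splittings), then `finRepMp s p = finRepMp s₁ p ⊠ finRepMp s₂ p`
(★ `mpSeesawChar_eq_one_of_mem_adelicMpTheta`). [cite: Weil1964, Chap. III n° 41 Thm. 6 p. 193] [cite: GelbartRogawski1991, §3.1 Remark p. 457] -/
theorem finRepMp_eq_finSumEnd_of_mem_adelicMpTheta (p : P)
    (hp : (s p : adelicMp F (ι₁ ⊕ ι₂) (Matrix.fromBlocks T₁ 0 0 T₂)) ∈ adelicMpTheta F (ι₁ ⊕ ι₂) (Matrix.fromBlocks T₁ 0 0 T₂))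
    (hp₁ : (s₁ p : adelicMp F ι₁ T₁) ∈ adelicMpTheta F ι₁ T₁) (hp₂ : (s₂ p : adelicMp F ι₂ T₂) ∈ adelicMpTheta F ι₂ T₂) :
    (finRepMp hT s harch p) =
      finSumEnd (finRepMp hT₁ s₁ harch₁ p) (finRepMp hT₂ s₂ harch₂ p) := by
  have h := finRepMp_eq_smul_finSumEnd s s₁ s₂ hs hT₁ hT₂ hT harch harch₁ harch₂ p
  rw [mpSeesawChar_eq_one_of_mem_adelicMpTheta s s₁ s₂ hs hT₁ hT₂ hp hp₁ hp₂, Units.val_one, one_smul] at h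
  exact h

/-- **On the nose for a trivial see-saw character** (the case `χ ∘ s = 1`, e.g. after renormalising one member by `χ⁻¹`):
`finRepMp s p = finRepMp s₁ p ⊠ finRepMp s₂ p`. [cite: Kudla1984, §1] [cite: MoeglinVignerasWaldspurger1987, Chap. 2 II.1] -/
theorem finRepMp_eq_finSumEnd_of_mpSeesawChar_eq_one (hχ : ∀ p, mpSeesawChar s s₁ s₂ hs hT₁ hT₂ p = 1) (p : P) :
    (finRepMp hT s harch p) =
      finSumEnd (finRepMp hT₁ s₁ harch₁ p) (finRepMp hT₂ s₂ harch₂ p) := by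
  have h := finRepMp_eq_smul_finSumEnd s s₁ s₂ hs hT₁ hT₂ hT harch harch₁ harch₂ p
  rw [hχ p, Units.val_one, one_smul] at h
  exact h

/-- **(L3) the intertwiner**: for a trivial see-saw character, `finSumEquiv : 𝒮 ⊗ 𝒮 ≃ 𝒮(⊕)` intertwines the tensor representation
`p ↦ finRepMp s₁ p ⊗ finRepMp s₂ p` with `p ↦ finRepMp s p` — the representation-level tensor decomposition of the finite Weil
representation of an orthogonal direct sum along the block-diagonal subgroup. [cite: Weil1964, Chap. III n° 37–38 pp. 188–190]
[cite: MoeglinVignerasWaldspurger1987, Chap. 2 II.1] -/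
theorem finSumEquiv_intertwines (hχ : ∀ p, mpSeesawChar s s₁ s₂ hs hT₁ hT₂ p = 1) (p : P) (x : FinSB F ι₁ ⊗[ℂ] FinSB F ι₂) :
    finRepMp hT s harch p (finSumEquiv F ι₁ ι₂ x) =
      finSumEquiv F ι₁ ι₂ (TensorProduct.map (finRepMp hT₁ s₁ harch₁ p) (finRepMp hT₂ s₂ harch₂ p) x) := by
  have h := finRepMp_comp_finSumEquiv s s₁ s₂ hs hT₁ hT₂ hT harch harch₁ harch₂ p
  rw [hχ p, Units.val_one, one_smul] at h
  exact LinearMap.congr_fun h x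

end Literature.NumberTheory.Weil1964

end
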